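/-
Copyright: the b2b-balaban T⁴-continuum CRUX team, row NE7b OWNER lineage `t4-ne7b-p1` (gen 124). Project licence.
-/
import Summits.QuantumFields.BalabanUV.T4Continuum.Spine.NE7b.SupZdPerturbedDecay
import Summits.QuantumFields.BalabanUV.T4Continuum.Spine.NE7b.SupZdCoarseForm

/-!
# KERNEL ALGEBRA ON THE BLOCK LATTICE `ℤ^d`: THE NEUMANN INVERSE OF `T + E` AROUND `M = T⁻¹` IN THE EXPONENTIALLY DECAYING CLASS —
# for kernels `|T(b,c)| ≤ C_Te^{−δ_T|b−c|₁}`, `|M(b,c)| ≤ C_Me^{−δ_M|b−c|₁}`, `TM = 1` (rows), and a perturbation `|E(b,c)| ≤ ηe^{−γ_E|b−c|₁}`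
# with `θ = (C_Me^{μd}K_{δ_M−μ})(ηe^{μd}K_{γ_E−μ}) ≤ 1∕2` (`0 < μ < min(δ_M, γ_E)`): the series `N = Σ_j(−ME)^jM` converges entrywise,
# `|N(b,c)| ≤ 2C_Me^{μd}K_{δ_M−μ}e^{−μ|b−c|₁}`, `N + M(EN) = M`, and `(T + E)N = 1` (rows absolutely convergent); and in the decaying class a
# LEFT inverse of a bounded kernel equals a RIGHT inverse (Fubini for `L·A·N`).  Pure bookkeeping on `ℓ^∞(ℤ^d)` and `ℕ × ℤ^d`, no road
# object: the engine that inverts the PERTURBED coarse operator `T_K = T + (T_K − T)` on `ℤ^d` around (194)'s `M` ((216) supplies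
# `|T_K − T| ≤ 4C_PK_{δ₀−μ}θe^{−μ|b−c|₁}`) — no floor, no `ℓ²`, no torus (row NE7b, node U5c; (215)∕(203)∕(189) BY NAME; [folklore])

Cell `pub-balaban`, sub-cell `t4`, spine estimate NE7b (`T4WeightBudget.RelWeightBound`; the cell's OWN estimate — NOT PRINTED in
[Bałaban 1983–89], NOT PROVED).  Crux-route work under `Spine/NE7b/` by the row OWNER (`t4-ne7b-p1` gen 124, file (217)) under FREEZE
(0)'s crux-prover clause; NOTHING of Bałaban's is named as a Lean object, valued or asserted; no `T4Continuum/Support` leaf typed; no `def`,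
no notation (the iterates WRITTEN OUT as `((−(M_op∘E_op))^j)(M_opδ_c)` with (203)'s kernel operators on `ℓ^∞(ℤ^d)`; `N`, `θ` displayed);
zero `sorry`.  Imports (BY NAME): the OWNER's (215) `…SupZdPerturbedDecay` (`kernel_profile_step`, `neumann_iterates_profile` — used at
MESH ZERO, where blocks are points; through it (203) `kernel_clm`, (189) `summable_exp_l1`, `tsum_exp_l1_le`, (27) `blk`, `side`),
(191) `…SupZdCoarseForm` (`natAbs_sub_comm_sum`),
Mathlib's `Summable.mul_of_nonneg`, `summable_prod_of_nonneg`, `Summable.tsum_comm`, `Summable.prod`, `Summable.tsum_eq_zero_add`,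
`summable_geometric_of_lt_one`, `tsum_geometric_of_lt_one`, `tsum_eq_single`, `norm_tsum_le_tsum_norm`.

WHY (located).  § [NE7bP1-G124-HANDOFF] NEXT (3)(a), `H + K` half: the perturbed next-scale Hessian on `ℤ^d` is `(n+1)^d·T_K⁻¹` with
`T_K(b,c) = (n+1)^{−d}Σ_{q∈B n b}Ψ^K_c(q)` ((216)).  (194) inverted `T = T_0` by finite sections and a FLOOR; for `T_K` no floor is
available on the sup road (symmetry of `K` is not assumed, (163)'s energy threshold is a torus statement).  But (216) (iii) gives
`T_K = T + E_K` with `E_K` exponentially decaying AND `O(ε)`, so `T_K⁻¹ = (1 + ME_K)⁻¹M` is a NEUMANN series in the algebra of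
exponentially decaying kernels — this file proves exactly that algebra statement, once, for abstract `T, M, E`: the iterates
`u_j = (−ME)^jM(·,c)` keep the profile `e^{−μ|·−c|₁}` with ratio `θ` ((215), §2 read at mesh `n = 0`, where `blk 0 = id`, with the
no-loss profile step for `M` and for `E`), the series converges geometrically (§2), the `E`- and `M`-rows pass through `Σ_j` (Fubini on
`ℕ × ℤ^d`, §2) giving the fixed-point form `N + M(EN) = M`, and the `T`-row passes through `M(EN)` by Fubini on `ℤ^d × ℤ^d` under
`C_Te^{−δ_T|b−b′|₁}C_Me^{−δ_M|b′−b″|₁}·sup|EN|`, where `TM = 1` collapses the inner sum: `TN = δ − EN`.  The two-sidedness `N(T+E) = 1` is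
obtained in the sequel from the TRANSPOSED data (a decaying left inverse) and §4 (`L = L(AN) = (LA)N = N`).

WHAT IS PROVED ([folklore]): §1 `blk_zero`, **`l1_profile_step`** (the profile step on `ℤ^d`); §2 **`series_profile`**, **`row_tsum_comm`**
(a decaying kernel row through a geometric series); §3 **`decaying_right_inverse`** (THE ENGINE: `∃ N` with the profile bound, the fixed-point
identity with its summabilities, and `Σ′(T+E)(b,b′)N(b′,c) = δ_{bc}` in split and joined form with summabilities); §4 **`left_inverse_eq_right_inverse`**.

HONEST (what this is NOT).  Abstract kernel algebra only — the road's `T_K⁻¹` (with (186)∕(195)∕(216)'s constants and the third smallness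
condition on `ε`) is the sequel; rows and profiles only (no operator-norm or `ℓ²` statement; `N` is not claimed symmetric); nothing of
the torus → `ℤ^d` limit for `H + K`; nothing of the covariant propagators of [B4]–[B6]; nothing of Bałaban's asserted.  BY-NAME EFFECT ON
THE WALL: NONE.  NE7b NOT PRINTED ∕ NOT PROVED; spine PROVED 0∕9; rung (B)+1 — the programme's measures remain FINITE-torus statements;
NOT the mass gap, NOT Clay.  HONEST DEPENDENCY: continuum YM on T⁴ ⇐ BetaPertH ∧ nine spine estimates (0∕9 proved); BetaPertH ⇐ (D1) ∧
(D4) ∧ CAP+tail; G-an2-4 gates asym, D1 and NE2∕3∕4.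
-/

set_option autoImplicit false

noncomputable section

namespace Summit.QuantumFields.BalabanUV.T4Continuum.NE7b.SupZdKernelNeumann

open Real Filter Topology
open scoped ENNReal
open Literature.MathematicalPhysics.QuantumFieldTheory.Balaban1983to89
open B6QGQLower276 (X blk side)
open SupZdExponentialSums (summable_exp_l1 tsum_exp_l1_le)
open SupZdCoarseForm (natAbs_sub_comm_sum)
open SupZdCoarseInverseOperator (kernel_clm)
open SupZdPerturbedDecay (kernel_profile_step neumann_iterates_profile)

variable {d : ℕ}

/-! ## §1. Mesh zero: blocks are points; the profile step on the block lattice -/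

/-- At mesh `n = 0` every block is a point: `blk 0 p = p`. -/
theorem blk_zero (p : X d) : blk 0 p = p := by
  funext i
  simp [blk, side]

/-- **THE PROFILE STEP ON `ℤ^d`**: `|A(b,c)| ≤ C_Ae^{−γ|b−c|₁}`, `|v(c)| ≤ Be^{−μ|c − b₀|₁}`, `0 ≤ μ < γ` ⟹ the row series converges and
`|Σ′_cA(b,c)v(c)| ≤ C_Ae^{μd}K_{γ−μ}B·e^{−μ|b − b₀|₁}` — (215)'s kernel step at mesh zero. [folklore] -/
theorem l1_profile_step {CA γ μ Bv : ℝ} (hCA : 0 ≤ CA) (hμ : 0 ≤ μ) (hμγ : μ < γ) (A : X d → X d → ℝ)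
    (hA : ∀ b c, |A b c| ≤ CA * exp (-(γ * ∑ i, (((b i - c i).natAbs : ℕ) : ℝ)))) (b₀ : X d) (v : X d → ℝ)
    (hv : ∀ c, |v c| ≤ Bv * exp (-(μ * ∑ i, (((c i - b₀ i).natAbs : ℕ) : ℝ)))) (b : X d) :
    Summable (fun c : X d => A b c * v c) ∧
    |∑' c : X d, A b c * v c| ≤ CA * exp (μ * d) * (2 * (1 - exp (-(γ - μ)))⁻¹) ^ d * Bv
      * exp (-(μ * ∑ i, (((b i - b₀ i).natAbs : ℕ) : ℝ))) := by
  have h := kernel_profile_step (d := d) 0 hCA hμ hμγ A hA b₀ v (fun c => by simpa only [blk_zero] using hv c) b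
  simpa only [blk_zero] using h

/-! ## §2. Geometric series of profiles; kernel rows through a geometric series -/

/-- **SERIES OF PROFILES**: `|u_j(b)| ≤ Bθ^j·w` (`0 ≤ θ ≤ 1∕2`, `w ≥ 0`) ⟹ `Σ_ju_j(b)` converges absolutely and `|Σ_ju_j(b)| ≤ 2B·w`.
[folklore] -/
theorem series_profile {B θ w : ℝ} (hB : 0 ≤ B) (hθ0 : 0 ≤ θ) (hθ1 : θ ≤ 1 / 2) (hw : 0 ≤ w) (u : ℕ → ℝ)
    (hu : ∀ j, |u j| ≤ B * θ ^ j * w) : Summable u ∧ |∑' j : ℕ, u j| ≤ 2 * B * w := by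
  have hθlt : θ < 1 := by linarith
  have hgeom := summable_geometric_of_lt_one hθ0 hθlt
  have hgs : Summable fun j : ℕ => B * θ ^ j * w := (hgeom.mul_left B).mul_right w
  have hs : Summable u := Summable.of_norm_bounded hgs fun j => by rw [Real.norm_eq_abs]; exact hu j
  refine ⟨hs, ?_⟩
  have h1 : |∑' j : ℕ, u j| ≤ ∑' j : ℕ, |u j| := by
    have := norm_tsum_le_tsum_norm hs.norm; simpa only [Real.norm_eq_abs] using this
  have h2 := hs.abs.tsum_le_tsum hu hgs
  have h3 : ∑' j : ℕ, B * θ ^ j * w = B * (∑' j : ℕ, θ ^ j) * w := by rw [← tsum_mul_left, ← tsum_mul_right]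
  have h4 : ∑' j : ℕ, θ ^ j ≤ 2 := by
    rw [tsum_geometric_of_lt_one hθ0 hθlt]
    calc (1 - θ)⁻¹ ≤ (1 / 2 : ℝ)⁻¹ := inv_anti₀ (by norm_num) (by linarith)
      _ = 2 := by norm_num
  rw [h3] at h2
  calc |∑' j : ℕ, u j| ≤ B * (∑' j : ℕ, θ ^ j) * w := h1.trans h2
    _ ≤ B * 2 * w := mul_le_mul_of_nonneg_right (mul_le_mul_of_nonneg_left h4 hB) hw
    _ = _ := by ring

/-- **A KERNEL ROW THROUGH A GEOMETRIC SERIES** (Fubini on `ℕ × ℤ^d`): `|A(b,c)| ≤ C_Ae^{−γ|b−c|₁}` (`γ > 0`), `|y_j(c)| ≤ Bθ^j`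
(`0 ≤ θ < 1`) ⟹ `Σ′_cA(b,c)·Σ_jy_j(c) = Σ_jΣ′_cA(b,c)y_j(c)`, the outer series converging. [folklore] -/
theorem row_tsum_comm {CA γ B θ : ℝ} (hCA : 0 ≤ CA) (hγ : 0 < γ) (hB : 0 ≤ B) (hθ0 : 0 ≤ θ) (hθ1 : θ < 1)
    (A : X d → X d → ℝ) (hA : ∀ b c, |A b c| ≤ CA * exp (-(γ * ∑ i, (((b i - c i).natAbs : ℕ) : ℝ))))
    (y : ℕ → X d → ℝ) (hy : ∀ j c, |y j c| ≤ B * θ ^ j) (b : X d) :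
    Summable (fun j : ℕ => ∑' c : X d, A b c * y j c) ∧
    ∑' c : X d, A b c * ∑' j : ℕ, y j c = ∑' j : ℕ, ∑' c : X d, A b c * y j c := by
  have hgeom := summable_geometric_of_lt_one hθ0 hθ1
  obtain ⟨F, hF⟩ : ∃ F : ℕ → X d → ℝ, ∀ j c, F j c = A b c * y j c := ⟨_, fun _ _ => rfl⟩
  have hdom : ∀ j c, |F j c| ≤ (B * θ ^ j) * (CA * exp (-(γ * ∑ i, (((b i - c i).natAbs : ℕ) : ℝ)))) := by
    intro j c
    rw [hF, abs_mul, mul_comm]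
    exact mul_le_mul (hy j c) (hA b c) (abs_nonneg _) (mul_nonneg hB (pow_nonneg hθ0 j))
  have hprod : Summable fun x : ℕ × X d => (B * θ ^ x.1) * (CA * exp (-(γ * ∑ i, (((b i - x.2 i).natAbs : ℕ) : ℝ)))) :=
    Summable.mul_of_nonneg (hgeom.mul_left B) ((summable_exp_l1 hγ b).mul_left CA)
      (fun j => mul_nonneg hB (pow_nonneg hθ0 j)) (fun c => by positivity)
  have hFsum : Summable (Function.uncurry F) :=
    Summable.of_norm_bounded hprod fun x => by simp only [Function.uncurry, Real.norm_eq_abs]; exact hdom x.1 x.2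
  have hsj : ∀ c, Summable fun j : ℕ => y j c := fun c =>
    Summable.of_norm_bounded (hgeom.mul_left B) fun j => by rw [Real.norm_eq_abs]; exact hy j c
  have hinner : ∀ c, ∑' j : ℕ, F j c = A b c * ∑' j : ℕ, y j c := fun c => by
    simp only [hF]; rw [tsum_mul_left]
  have hrow : ∑' c : X d, A b c * ∑' j : ℕ, y j c = ∑' j : ℕ, ∑' c : X d, F j c := by
    rw [show (fun c : X d => A b c * ∑' j : ℕ, y j c) = fun c => ∑' j : ℕ, F j c from funext fun c => (hinner c).symm]
    exact hFsum.tsum_comm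
  refine ⟨?_, ?_⟩
  · have h := hFsum.prod_factor
    -- `j ↦ Σ′_c F j c` is summable
    have h2 : Summable fun j : ℕ => ∑' c : X d, Function.uncurry F (j, c) := hFsum.prod
    simpa only [Function.uncurry, hF] using h2
  · rw [hrow]; simp only [hF]

/-! ## §3. The decaying right inverse of `T + E` by the Neumann series around `M = T⁻¹` -/

/-- **DECAYING RIGHT INVERSE BY NEUMANN**: kernels `T, M, E` on `ℤ^d` with `|T(b,c)| ≤ C_Te^{−δ_T|b−c|₁}`, `|M(b,c)| ≤ C_Me^{−δ_M|b−c|₁}`,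
`|E(b,c)| ≤ ηe^{−γ_E|b−c|₁}`, `Σ′_{b″}T(b,b″)M(b″,c) = δ_{bc}`, a rate `0 < μ < min(δ_M, γ_E)` and the smallness
`θ := (C_Me^{μd}K_{δ_M−μ})·(ηe^{μd}K_{γ_E−μ}) ≤ 1∕2` ⟹ there is a kernel `N` with `|N(b,c)| ≤ 2C_Me^{μd}K_{δ_M−μ}·e^{−μ|b−c|₁}`,
`N + M(EN) = M` (the fixed-point form) and `Σ′_{b″}(T + E)(b,b″)N(b″,c) = δ_{bc}` (rows absolutely convergent) — `N(·,c) = Σ_j(−ME)^jM(·,c)`: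
the iterates keep the profile ((215), §2 at mesh zero), the series converges geometrically, `M`, `E` rows pass through `Σ_j` (§2), and
`T` through `M(EN)` by Fubini on `ℤ^d × ℤ^d` with `TM = 1`. [folklore] -/
theorem decaying_right_inverse {CT δT CM δM η γE μ : ℝ} (hCT : 0 ≤ CT) (hδT : 0 < δT) (hCM : 0 ≤ CM) (hη : 0 ≤ η)
    (hμ : 0 < μ) (hμM : μ < δM) (hμE : μ < γE) (T M E : X d → X d → ℝ)
    (hT : ∀ b c, |T b c| ≤ CT * exp (-(δT * ∑ i, (((b i - c i).natAbs : ℕ) : ℝ))))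
    (hMd : ∀ b c, |M b c| ≤ CM * exp (-(δM * ∑ i, (((b i - c i).natAbs : ℕ) : ℝ))))
    (hE : ∀ b c, |E b c| ≤ η * exp (-(γE * ∑ i, (((b i - c i).natAbs : ℕ) : ℝ))))
    (hTM : ∀ b c, ∑' b'' : X d, T b b'' * M b'' c = if b = c then 1 else 0)
    (hsmall : (CM * exp (μ * d) * (2 * (1 - exp (-(δM - μ)))⁻¹) ^ d) * (η * exp (μ * d) * (2 * (1 - exp (-(γE - μ)))⁻¹) ^ d) ≤ 1 / 2) :
    ∃ N : X d → X d → ℝ,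
      (∀ b c, |N b c| ≤ 2 * (CM * exp (μ * d) * (2 * (1 - exp (-(δM - μ)))⁻¹) ^ d) * exp (-(μ * ∑ i, (((b i - c i).natAbs : ℕ) : ℝ)))) ∧
      (∀ b c, (∀ b', Summable fun c' : X d => E b' c' * N c' c) ∧ Summable (fun b' : X d => M b b' * ∑' c' : X d, E b' c' * N c' c) ∧
        N b c + ∑' b' : X d, M b b' * ∑' c' : X d, E b' c' * N c' c = M b c) ∧
      (∀ b c, Summable (fun b' : X d => T b b' * N b' c) ∧ Summable (fun b' : X d => E b b' * N b' c) ∧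
        Summable (fun b' : X d => (T b b' + E b b') * N b' c) ∧
        ∑' b' : X d, T b b' * N b' c + ∑' b' : X d, E b b' * N b' c = (if b = c then 1 else 0) ∧
        ∑' b' : X d, (T b b' + E b b') * N b' c = if b = c then 1 else 0) := by
  classical
  have hδM : 0 < δM := lt_trans hμ hμM
  have hγE : 0 < γE := lt_trans hμ hμE
  have hKM : 0 < (2 * (1 - exp (-(δM - μ)))⁻¹) ^ d := pow_pos (mul_pos two_pos (inv_pos.2 (sub_pos.2 (exp_lt_one_iff.2 (by linarith))))) d
  have hKE : 0 < (2 * (1 - exp (-(γE - μ)))⁻¹) ^ d := pow_pos (mul_pos two_pos (inv_pos.2 (sub_pos.2 (exp_lt_one_iff.2 (by linarith))))) d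
  obtain ⟨CP, hCP⟩ : ∃ CP : ℝ, CP = CM * exp (μ * d) * (2 * (1 - exp (-(δM - μ)))⁻¹) ^ d := ⟨_, rfl⟩
  have hCP0 : 0 ≤ CP := by rw [hCP]; positivity
  obtain ⟨LE, hLE⟩ : ∃ LE : ℝ, LE = η * exp (μ * d) * (2 * (1 - exp (-(γE - μ)))⁻¹) ^ d := ⟨_, rfl⟩
  have hLE0 : 0 ≤ LE := by rw [hLE]; positivity
  obtain ⟨θ, hθ⟩ : ∃ θ : ℝ, θ = CP * LE := ⟨_, rfl⟩
  have hθ0 : 0 ≤ θ := by rw [hθ]; exact mul_nonneg hCP0 hLE0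
  have hθ1 : θ ≤ 1 / 2 := by rw [hθ, hCP, hLE]; exact hsmall
  have hθlt : θ < 1 := by linarith
  rw [← hCP]
  obtain ⟨Mop, -, hMop⟩ := kernel_clm (d := d) hCM hδM M hMd
  obtain ⟨Eop, -, hEop⟩ := kernel_clm (d := d) hη hγE E hE
  -- point indicators in `ℓ^∞`, profile `1`
  have hmem : ∀ c : X d, Memℓp (fun b : X d => if b = c then (1 : ℝ) else 0) ∞ := fun c => memℓp_infty ⟨1, by
    rintro _ ⟨q, rfl⟩
    show ‖(if q = c then (1 : ℝ) else 0)‖ ≤ 1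
    split_ifs <;> simp⟩
  obtain ⟨fl, hfl⟩ : ∃ fl : X d → lp (fun _ : X d => ℝ) ∞, ∀ c q, fl c q = if q = c then (1 : ℝ) else 0 :=
    ⟨fun c => ⟨_, hmem c⟩, fun _ _ => rfl⟩
  have hflprof : ∀ c q, |fl c q| ≤ 1 * exp (-(μ * ∑ i, (((blk 0 q i - c i).natAbs : ℕ) : ℝ))) := by
    intro c q
    rw [hfl, blk_zero]
    split_ifs with h
    · rw [h]; simp
    · rw [abs_zero]; positivity
  -- `M` keeps profiles of rate `μ < δ_M` with constant `C_P` (mesh-zero form for (215), §2)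
  have hprof : ∀ (c : X d) (Mg : ℝ) (g : lp (fun _ : X d => ℝ) ∞),
      (∀ q, |g q| ≤ Mg * exp (-(μ * ∑ i, (((blk 0 q i - c i).natAbs : ℕ) : ℝ)))) →
      ∀ q, |Mop g q| ≤ CP * Mg * exp (-(μ * ∑ i, (((blk 0 q i - c i).natAbs : ℕ) : ℝ))) := by
    intro c Mg g hg q
    have h := (kernel_profile_step (d := d) 0 hCM hμ.le hμM M hMd c (fun q => g q) hg q).2
    rw [hMop, hCP]
    calc _ ≤ _ := h
      _ = _ := by ring
  -- the iterates `u_j = (−ME)^jM(·,c)` and their profile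
  obtain ⟨useq, huseq⟩ : ∃ useq : X d → ℕ → X d → ℝ, ∀ c j q, useq c j q = (((-(Mop.comp Eop)) ^ j) (Mop (fl c))) q :=
    ⟨_, fun _ _ _ => rfl⟩
  have hiter : ∀ c j q, |useq c j q| ≤ CP * θ ^ j * exp (-(μ * ∑ i, (((q i - c i).natAbs : ℕ) : ℝ))) := by
    intro c j q
    have h := neumann_iterates_profile (d := d) 0 hη hμ.le hμE E hE Mop Eop hEop c (hprof c) (fl c) 1 (hflprof c) j q
    rw [huseq, hθ, hLE]
    simp only [blk_zero, mul_one] at h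
    exact h
  have hiter' : ∀ c j q, |useq c j q| ≤ CP * θ ^ j := fun c j q =>
    (hiter c j q).trans (mul_le_of_le_one_right (by positivity) (exp_le_one_iff.2 (neg_nonpos.2 (by positivity))))
  -- the recursion, pointwise
  have hrec0 : ∀ c q, useq c 0 q = M q c := by
    intro c q
    rw [huseq, pow_zero]
    change Mop (fl c) q = M q c
    rw [hMop, tsum_eq_single c (fun b' (hb' : b' ≠ c) => by rw [hfl, if_neg hb', mul_zero]), hfl, if_pos rfl, mul_one]
  have hrecS : ∀ c j q, useq c (j + 1) q = -(∑' b' : X d, M q b' * ∑' c' : X d, E b' c' * useq c j c') := by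
    intro c j q
    obtain ⟨w, hw⟩ : ∃ w : lp (fun _ : X d => ℝ) ∞, w = ((-(Mop.comp Eop)) ^ j) (Mop (fl c)) := ⟨_, rfl⟩
    have hwq : ∀ q', w q' = useq c j q' := fun q' => by rw [hw, huseq]
    have hstep : (((-(Mop.comp Eop)) ^ (j + 1)) (Mop (fl c))) q = -(Mop (Eop w) q) := by
      rw [pow_succ', hw]
      rfl
    rw [huseq, hstep, hMop]
    congr 1
    exact tsum_congr fun b' => by rw [hEop]; simp only [hwq]
  -- the series `N(q,c) = Σ_j u_j(q)`
  obtain ⟨N, hN⟩ : ∃ N : X d → X d → ℝ, ∀ q c, N q c = ∑' j : ℕ, useq c j q := ⟨_, fun _ _ => rfl⟩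
  have hNs : ∀ q c, Summable (fun j : ℕ => useq c j q) ∧
      |N q c| ≤ 2 * CP * exp (-(μ * ∑ i, (((q i - c i).natAbs : ℕ) : ℝ))) := by
    intro q c
    rw [hN]
    exact series_profile hCP0 hθ0 hθ1 (exp_pos _).le (fun j => useq c j q) (fun j => hiter c j q)
  have hNprof : ∀ q c, |N q c| ≤ 2 * CP * exp (-(μ * ∑ i, (((q i - c i).natAbs : ℕ) : ℝ))) := fun q c => (hNs q c).2
  -- `E N(·,c)`: rows converge, profile `L_E·2C_P`
  have hEN : ∀ c b', Summable (fun c' : X d => E b' c' * N c' c) ∧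
      |∑' c' : X d, E b' c' * N c' c| ≤ LE * (2 * CP) * exp (-(μ * ∑ i, (((b' i - c i).natAbs : ℕ) : ℝ))) := by
    intro c b'
    have h := l1_profile_step (d := d) hη hμ.le hμE E hE c (fun c' => N c' c) (fun c' => hNprof c' c) b'
    rw [hLE]; exact h
  -- the fixed-point identity `N + M(EN) = M`
  have hfix : ∀ q c, Summable (fun b' : X d => M q b' * ∑' c' : X d, E b' c' * N c' c) ∧
      N q c + ∑' b' : X d, M q b' * ∑' c' : X d, E b' c' * N c' c = M q c := by
    intro q c
    -- inner rows through `Σ_j`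
    have hin : ∀ b', Summable (fun j : ℕ => ∑' c' : X d, E b' c' * useq c j c') ∧
        ∑' c' : X d, E b' c' * N c' c = ∑' j : ℕ, ∑' c' : X d, E b' c' * useq c j c' := by
      intro b'
      have h := row_tsum_comm (d := d) hη hγE hCP0 hθ0 hθlt E hE (fun j c' => useq c j c') (fun j c' => hiter' c j c') b'
      simp only [← hN] at h
      exact h
    -- the `E`-rows of the iterates are geometric: `|Σ′E(b′,c′)u_j(c′)| ≤ L_E·C_Pθ^j`
    have hY : ∀ j b', |∑' c' : X d, E b' c' * useq c j c'| ≤ LE * CP * θ ^ j := by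
      intro j b'
      have h := (l1_profile_step (d := d) hη hμ.le hμE E hE c (fun c' => useq c j c') (fun c' => hiter c j c') b').2
      rw [hLE]
      calc _ ≤ η * exp (μ * d) * (2 * (1 - exp (-(γE - μ)))⁻¹) ^ d * (CP * θ ^ j)
            * exp (-(μ * ∑ i, (((b' i - c i).natAbs : ℕ) : ℝ))) := h
        _ ≤ η * exp (μ * d) * (2 * (1 - exp (-(γE - μ)))⁻¹) ^ d * (CP * θ ^ j) * 1 := by
            gcongr; exact exp_le_one_iff.2 (neg_nonpos.2 (by positivity))
        _ = _ := by ring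
    -- outer row through `Σ_j`
    have hout := row_tsum_comm (d := d) hCM hδM (mul_nonneg hLE0 hCP0) hθ0 hθlt M hMd
      (fun j b' => ∑' c' : X d, E b' c' * useq c j c') (fun j b' => hY j b') q
    have e1 : (fun b' : X d => M q b' * ∑' c' : X d, E b' c' * N c' c)
        = fun b' => M q b' * ∑' j : ℕ, ∑' c' : X d, E b' c' * useq c j c' := funext fun b' => by rw [(hin b').2]
    rw [e1]
    refine ⟨?_, ?_⟩
    · -- summability of the outer row: domination by `C_Me^{−δ_M|q−b′|₁}·(2L_EC_P)`
      refine Summable.of_norm_bounded ((summable_exp_l1 hδM q).mul_left (CM * (2 * (LE * CP)))) fun b' => ?_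
      rw [Real.norm_eq_abs, abs_mul]
      have hs := series_profile (B := LE * CP) (mul_nonneg hLE0 hCP0) hθ0 hθ1 zero_le_one
        (fun j => ∑' c' : X d, E b' c' * useq c j c') (fun j => by rw [mul_one]; exact hY j b')
      calc |M q b'| * |∑' j : ℕ, ∑' c' : X d, E b' c' * useq c j c'|
          ≤ CM * exp (-(δM * ∑ i, (((q i - b' i).natAbs : ℕ) : ℝ))) * (2 * (LE * CP) * 1) :=
            mul_le_mul (hMd q b') hs.2 (abs_nonneg _) (by positivity)
        _ = _ := by ring
    · rw [hout.2]
      have e2 : ∀ j, ∑' b' : X d, M q b' * ∑' c' : X d, E b' c' * useq c j c' = -useq c (j + 1) q := fun j => by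
        rw [hrecS, neg_neg]
      rw [tsum_congr e2, tsum_neg, hN, (hNs q c).1.tsum_eq_zero_add, hrec0]
      ring
  refine ⟨N, hNprof, fun b c => ⟨fun b' => (hEN c b').1, hfix b c⟩, fun b c => ?_⟩
  -- `T`-rows: `TN = TM − T(M(EN)) = δ − EN`
  have hB1 : ∀ b', |∑' c' : X d, E b' c' * N c' c| ≤ LE * (2 * CP) := fun b' =>
    (hEN c b').2.trans (mul_le_of_le_one_right (by positivity) (exp_le_one_iff.2 (neg_nonpos.2 (by positivity))))
  have hsTM : Summable fun b' : X d => T b b' * M b' c :=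
    Summable.of_norm_bounded ((summable_exp_l1 hδT b).mul_left (CT * CM)) fun b' => by
      rw [Real.norm_eq_abs, abs_mul]
      calc |T b b'| * |M b' c| ≤ CT * exp (-(δT * ∑ i, (((b i - b' i).natAbs : ℕ) : ℝ))) * (CM * 1) :=
            mul_le_mul (hT b b') ((hMd b' c).trans (by gcongr; exact exp_le_one_iff.2 (neg_nonpos.2 (by positivity))))
              (abs_nonneg _) (by positivity)
        _ = _ := by ring
  -- Fubini for `Σ_{b′}Σ_{b″} T(b,b′)M(b′,b″)(EN)(b″)`
  obtain ⟨F, hF⟩ : ∃ F : X d → X d → ℝ, ∀ b' b'', F b' b'' = T b b' * (M b' b'' * ∑' c' : X d, E b'' c' * N c' c) :=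
    ⟨_, fun _ _ => rfl⟩
  obtain ⟨g, hg⟩ : ∃ g : X d × X d → ℝ, ∀ p, g p = CT * exp (-(δT * ∑ i, (((b i - p.1 i).natAbs : ℕ) : ℝ)))
      * (CM * exp (-(δM * ∑ i, (((p.1 i - p.2 i).natAbs : ℕ) : ℝ))) * (LE * (2 * CP))) := ⟨_, fun _ => rfl⟩
  have hg0 : 0 ≤ g := fun p => by rw [hg]; positivity
  have hgsum : Summable g := by
    refine (summable_prod_of_nonneg hg0).2 ⟨fun b' => ?_, ?_⟩
    · simp only [hg]; exact ((summable_exp_l1 hδM b').mul_left CM).mul_right _ |>.mul_left _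
    · have hrow : ∀ b', ∑' b'', g (b', b'') ≤ CT * exp (-(δT * ∑ i, (((b i - b' i).natAbs : ℕ) : ℝ)))
          * (CM * (2 * (1 - exp (-δM))⁻¹) ^ d * (LE * (2 * CP))) := by
        intro b'
        simp only [hg]
        rw [tsum_mul_left, tsum_mul_right, tsum_mul_left]
        gcongr
        exact tsum_exp_l1_le hδM b'
      exact Summable.of_nonneg_of_le (fun b' => tsum_nonneg fun b'' => hg0 (b', b'')) hrow
        ((summable_exp_l1 hδT b).mul_left CT |>.mul_right _)
  have hFsum : Summable (Function.uncurry F) :=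
    Summable.of_norm_bounded hgsum fun p => by
      simp only [Function.uncurry, hF, hg, Real.norm_eq_abs, abs_mul]
      exact mul_le_mul (hT b p.1) (mul_le_mul (hMd p.1 p.2) (hB1 p.2) (abs_nonneg _) (by positivity)) (by positivity) (by positivity)
  have hcomm : ∑' b' : X d, ∑' b'' : X d, F b' b'' = ∑' b'' : X d, ∑' b' : X d, F b' b'' := hFsum.tsum_comm.symm
  -- `T N = T M − Σ_{b′}Σ_{b″}F`
  have hFrow : ∀ b', ∑' b'' : X d, F b' b'' = T b b' * ∑' b'' : X d, M b' b'' * ∑' c' : X d, E b'' c' * N c' c := fun b' => by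
    simp only [hF]; exact tsum_mul_left
  have hTN_pt : ∀ b', T b b' * N b' c = T b b' * M b' c - ∑' b'' : X d, F b' b'' := fun b' => by
    rw [hFrow, eq_sub_of_add_eq (hfix b' c).2, mul_sub]
  have hsF1 : Summable fun b' : X d => ∑' b'' : X d, F b' b'' := by
    have h := hFsum.prod
    simpa only [Function.uncurry] using h
  have hsTN : Summable fun b' : X d => T b b' * N b' c :=
    (hsTM.sub hsF1).congr fun b' => by rw [hTN_pt]
  have hin : ∀ b'', ∑' b' : X d, F b' b'' = (if b = b'' then 1 else 0) * ∑' c' : X d, E b'' c' * N c' c := fun b'' => by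
    have e : ∀ b', F b' b'' = (T b b' * M b' b'') * ∑' c' : X d, E b'' c' * N c' c := fun b' => by rw [hF, mul_assoc]
    rw [tsum_congr e, tsum_mul_right, hTM]
  have hTN : ∑' b' : X d, T b b' * N b' c = (if b = c then 1 else 0) - ∑' c' : X d, E b c' * N c' c := by
    rw [tsum_congr hTN_pt, hsTM.tsum_sub hsF1, hTM, hcomm, tsum_congr hin,
      tsum_eq_single b (fun b'' (hb'' : b'' ≠ b) => by rw [if_neg (fun h => hb'' h.symm), zero_mul]), if_pos rfl, one_mul]
  have hsEN : Summable fun b' : X d => E b b' * N b' c := (hEN c b).1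
  refine ⟨hsTN, hsEN, (hsTN.add hsEN).congr fun b' => by ring, by rw [hTN]; ring, ?_⟩
  rw [show (fun b' : X d => (T b b' + E b b') * N b' c) = fun b' => T b b' * N b' c + E b b' * N b' c from funext fun b' => by ring,
    hsTN.tsum_add hsEN, hTN]
  ring

/-! ## §4. A decaying left inverse equals a decaying right inverse -/

/-- **LEFT INVERSE = RIGHT INVERSE** in the decaying class: `A` bounded, `L` and `N` exponentially decaying, `Σ′_{b′}A(b,b′)N(b′,c) = δ_{bc}`
and `Σ′_{b′}L(b,b′)A(b′,c) = δ_{bc}` ⟹ `L = N` — the triple product `L·A·N` converges absolutely on `ℤ^d × ℤ^d` (domination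
`C_Le^{−μ_L|b−b′|₁}·C_A·C_Ne^{−μ_N|c′−c|₁}`), so `L = L(AN) = (LA)N = N` by Fubini. [folklore] -/
theorem left_inverse_eq_right_inverse {CL μL CA CN μN : ℝ} (hCL : 0 ≤ CL) (hμL : 0 < μL) (hCA : 0 ≤ CA) (hCN : 0 ≤ CN) (hμN : 0 < μN)
    (A L N : X d → X d → ℝ) (hA : ∀ b c, |A b c| ≤ CA)
    (hL : ∀ b c, |L b c| ≤ CL * exp (-(μL * ∑ i, (((b i - c i).natAbs : ℕ) : ℝ))))
    (hN : ∀ b c, |N b c| ≤ CN * exp (-(μN * ∑ i, (((b i - c i).natAbs : ℕ) : ℝ))))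
    (hAN : ∀ b c, ∑' b' : X d, A b b' * N b' c = if b = c then 1 else 0)
    (hLA : ∀ b c, ∑' b' : X d, L b b' * A b' c = if b = c then 1 else 0) (b c : X d) :
    L b c = N b c := by
  classical
  obtain ⟨F, hF⟩ : ∃ F : X d → X d → ℝ, ∀ b' c', F b' c' = (L b b' * A b' c') * N c' c := ⟨_, fun _ _ => rfl⟩
  have hNc : ∀ c', |N c' c| ≤ CN * exp (-(μN * ∑ i, (((c i - c' i).natAbs : ℕ) : ℝ))) := fun c' => by
    rw [natAbs_sub_comm_sum]; exact hN c' c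
  have hprod : Summable fun p : X d × X d => (CL * exp (-(μL * ∑ i, (((b i - p.1 i).natAbs : ℕ) : ℝ))) * CA)
      * (CN * exp (-(μN * ∑ i, (((c i - p.2 i).natAbs : ℕ) : ℝ)))) :=
    Summable.mul_of_nonneg (((summable_exp_l1 hμL b).mul_left CL).mul_right CA) ((summable_exp_l1 hμN c).mul_left CN)
      (fun _ => by positivity) (fun _ => by positivity)
  have hFsum : Summable (Function.uncurry F) := Summable.of_norm_bounded hprod fun p => by
    simp only [Function.uncurry, hF, Real.norm_eq_abs, abs_mul]
    exact mul_le_mul (mul_le_mul (hL b p.1) (hA p.1 p.2) (abs_nonneg _) (by positivity)) (hNc p.2) (abs_nonneg _) (by positivity)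
  have h1 : ∑' b' : X d, ∑' c' : X d, F b' c' = L b c := by
    have e : ∀ b', ∑' c' : X d, F b' c' = L b b' * (if b' = c then 1 else 0) := fun b' => by
      have e' : ∀ c', F b' c' = L b b' * (A b' c' * N c' c) := fun c' => by rw [hF, mul_assoc]
      rw [tsum_congr e', tsum_mul_left, hAN]
    rw [tsum_congr e, tsum_eq_single c (fun b' (hb' : b' ≠ c) => by rw [if_neg hb', mul_zero]), if_pos rfl, mul_one]
  have h2 : ∑' c' : X d, ∑' b' : X d, F b' c' = N b c := by
    have e : ∀ c', ∑' b' : X d, F b' c' = (if b = c' then 1 else 0) * N c' c := fun c' => by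
      simp only [hF]; rw [tsum_mul_right, hLA]
    rw [tsum_congr e, tsum_eq_single b (fun c' (hc' : c' ≠ b) => by rw [if_neg (fun h => hc' h.symm), zero_mul]), if_pos rfl, one_mul]
  rw [← h1, ← hFsum.tsum_comm, h2]

end Summit.QuantumFields.BalabanUV.T4Continuum.NE7b.SupZdKernelNeumann
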